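import Summits.BirchSwinnertonDyer.BirchSwinnertonDyer.Theorems.PrintCf2SplitBadTwoCMShaLocalCyclicInput
import Summits.BirchSwinnertonDyer.BirchSwinnertonDyer.Theorems.PrintCf2SplitBadTwoLocalPointsScalarDyadic
import Literature.NumberTheory.EllipticCurves.StrictSelmerRankOne
import HarnessLib

/-!
# Crux `PrintCf2.SplitBadTwoRankOneOfFacts` (stmt-BirchSwinnertonDyer-20368), road α v10.3, S3c residual (R-BV): the LOCAL CYCLICITY (T-loc-cl)
# at a split dyadic place is a THEOREM — `E(K_v) ⊇ ℤ₂` of finite index ⟹ (P-cyc) ⟹ (T-loc-cl)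

Cell `bsd-print-cf2`, EXTRA WIDTH seat `bsd-line-cf2-p1-w3` g9 (prover-bsd-line-cf2-p1-w3-g9-0); `--supports stmt-BirchSwinnertonDyer-20368`
(helper, Theses-free). HONEST FRAMING: nothing here closes the crux or a registered stub; BSD is not proved by any of this; no summit statement
is proved by this seat. No definition, no named fact, no `sorry`, no kit. beyond-print theorem: no.

WHY. Cut 13 of LEAD g12 (`restrictedControl_two_of_ptFacts_factor_values`, p674799) displays S3c ⟸ three cited facts ∧ (F1) ∧ (F3) ∧ (H2) ∧
`hcl`, where `hcl` = (T-loc-cl)-all (p674464, this seat): on every frame the `2`-torsion of `loc_v` of the classical-at-`v` classes of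
`H¹(⊤, E[2^∞])` is cyclic. -w8 g2 reduced (T-loc-cl) at `v` to the point statement (P-cyc) «of two points `R, R′ ∈ E(K̄_v)` with `2R, 2R′ ∈
E(K_v) + E[2^∞]`, one of `R, R′, R′ − R` lies in `E(K_v) + E[2^∞]`» (`CMPrimes.loc_localKerOver_cyclic_of_points`, p674679), and -w7 g3 proved
`E(K_v) ⊇ U ≅ ℤ₂` of finite index for `[K_v : ℚ₂] = 1` (`LocalPointsScalar.exists_finiteIndex_addEquiv_padicInt_of_finrank_eq_one`, Silverman
VII.6.3). This file supplies the algebra in between and concludes.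

WHAT.
* §1–§2 (pure algebra) `ideal_two_trichotomy` (a non-zero ideal `I` of `ℤ_[2]` has `I/2I = 𝔽₂`),
  **`trichotomy_of_finiteIndex_addEquiv_padicInt`**: an abelian group `G` with a finite-index subgroup `U ≃+ ℤ_[2]` satisfies «of any `x, y`, one of
  `x, y, x − y` lies in `2G + G_tors`» (`φ = e_U ∘ (N•·) : G → ℤ₂` has torsion kernel and its image is an ideal, since it contains the open `Nℤ₂ =
  2^aℤ₂` and `ℕ` is dense).
* §3 `exists_twoPow_torsion_sub_fixed` (halving up to `2`-power torsion under a group action: the odd part of the torsion defect is absorbed by a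
  unit mod `2^{k+1}`), **`point_trichotomy`** ((P-cyc) for any `Γ`-module `A` whose fixed points are the image of a group with a finite-index `ℤ₂`).
* §4 `smul_map_baseChange_eq` (`E(K_v) → E(K̄_v)` lands in the fixed points; the converse is the tree's `exists_map_eq_of_forall_smul_localPoints_eq`),
  **`point_trichotomy_adicCompletion_two`** ((P-cyc) for every elliptic `V/K`, `K` imaginary quadratic, `v ≠ v̄ ∣ 2`) and
  **`classical_local_cyclic`**: (T-loc-cl) at `v` — `hcl` of cut 13 per frame, with NO hypothesis beyond the frame's `hK, hv, hv̄, hne`.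

presearch: Silverman AEC VII.6.3 (held, p0204) — the structure `E(K_v) ≅ ℤ_p^{[K_v:ℚ_p]} × finite`; tree: `LocalPointsFiniteIndexLattice*`. No Literature fact filed.

References: [SilvermanAEC2009] Prop. VII.6.3, VIII §1; [GreenbergLNM1716] §2 Prop. 2.1–2.2; [Agboola2007] §6 (arXiv p0014:L5).
-/

noncomputable section

open scoped Classical

set_option linter.dupNamespace false
set_option autoImplicit false

open Function

namespace Summit.BirchSwinnertonDyer.BirchSwinnertonDyer.Theorems.PrintCf2.LocalTrichotomy

/-! ## §1. Ideals of `ℤ_[2]`: two elements of a non-zero ideal `I` not in `2I` differ by an element of `2I` -/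

/-- **Two elements of `ℤ_[2]` not divisible by `2` differ by a multiple of `2`** (`ℤ₂/2ℤ₂ = 𝔽₂`). [folklore] -/
theorem two_dvd_sub_of_not_dvd {s t : ℤ_[2]} (hs : ¬ (2 : ℤ_[2]) ∣ s) (ht : ¬ (2 : ℤ_[2]) ∣ t) : (2 : ℤ_[2]) ∣ s - t := by
  have h01 : ∀ x : ZMod 2, x ≠ 0 → x = 1 := by decide
  haveI : Fact (Nat.Prime 2) := ⟨Nat.prime_two⟩
  have hker : ∀ x : ℤ_[2], PadicInt.toZMod x = 0 ↔ (2 : ℤ_[2]) ∣ x := fun x ↦ by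
    rw [← RingHom.mem_ker, PadicInt.ker_toZMod, PadicInt.maximalIdeal_eq_span_p, Ideal.mem_span_singleton, Nat.cast_ofNat]
  have hs1 := h01 _ (mt (hker s).mp hs)
  have ht1 := h01 _ (mt (hker t).mp ht)
  rw [← hker, map_sub, hs1, ht1, sub_self]

/-- **In a non-zero ideal `I` of `ℤ_[2]`, of any two elements one lies in `2I` or their difference does** (`I = 2^nℤ₂`, `I/2I = 𝔽₂`).
[folklore] -/
theorem ideal_two_trichotomy (I : Ideal ℤ_[2]) (hI : I ≠ ⊥) {s t : ℤ_[2]} (hs : s ∈ I) (ht : t ∈ I) :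
    (∃ s' ∈ I, s = 2 * s') ∨ (∃ t' ∈ I, t = 2 * t') ∨ (∃ w ∈ I, s - t = 2 * w) := by
  haveI : Fact (Nat.Prime 2) := ⟨Nat.prime_two⟩
  obtain ⟨n, rfl⟩ := IsDiscreteValuationRing.ideal_eq_span_pow_irreducible hI (PadicInt.irreducible_p (p := 2))
  rw [Nat.cast_ofNat] at hs ht ⊢
  obtain ⟨s₁, rfl⟩ := Ideal.mem_span_singleton'.mp hs
  obtain ⟨t₁, rfl⟩ := Ideal.mem_span_singleton'.mp ht
  by_cases h2s : (2 : ℤ_[2]) ∣ s₁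
  · obtain ⟨s₂, rfl⟩ := h2s
    exact Or.inl ⟨s₂ * 2 ^ n, Ideal.mem_span_singleton'.mpr ⟨s₂, rfl⟩, by ring⟩
  by_cases h2t : (2 : ℤ_[2]) ∣ t₁
  · obtain ⟨t₂, rfl⟩ := h2t
    exact Or.inr (Or.inl ⟨t₂ * 2 ^ n, Ideal.mem_span_singleton'.mpr ⟨t₂, rfl⟩, by ring⟩)
  obtain ⟨w, hw⟩ := two_dvd_sub_of_not_dvd h2s h2t
  refine Or.inr (Or.inr ⟨w * 2 ^ n, Ideal.mem_span_singleton'.mpr ⟨w, rfl⟩, ?_⟩)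
  rw [← sub_mul, hw]; ring

/-! ## §2. The trichotomy -/

section Group

variable {G : Type*} [AddCommGroup G]

/-- **TRICHOTOMY.** If an abelian group `G` has a finite-index subgroup `U ≃+ ℤ_[2]`, then of any two elements `x, y` one of `x`, `y`, `x − y` lies in
`2G + G_tors`. (With `N = [G : U]`, `φ = e_U ∘ (N • ·) : G → ℤ_[2]` has torsion kernel and its image is an ideal `2^jℤ₂ ⊇ Nℤ₂` of `ℤ_[2]`
— it contains the open subgroup `Nℤ₂ = 2^aℤ₂` and `ℕ` is dense in `ℤ₂` —, and `2^jℤ₂/2^{j+1}ℤ₂ = 𝔽₂`.) The structure `E(ℚ₂) ⊇ ℤ₂` of finite index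
used by the local cyclicity (T-loc-cl). [cite: SilvermanAEC2009, Prop. VII.6.3] -/
theorem trichotomy_of_finiteIndex_addEquiv_padicInt (U : AddSubgroup G) [U.FiniteIndex] (eU : U ≃+ ℤ_[2]) (x y : G) :
    (∃ z : G, IsOfFinAddOrder (x - 2 • z)) ∨ (∃ z : G, IsOfFinAddOrder (y - 2 • z)) ∨ (∃ z : G, IsOfFinAddOrder (x - y - 2 • z)) := by
  haveI : Fact (Nat.Prime 2) := ⟨Nat.prime_two⟩
  have hN : U.index ≠ 0 := AddSubgroup.FiniteIndex.index_ne_zero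
  -- `φ = eU ∘ (N • ·)`
  let φ : G →+ ℤ_[2] := AddMonoidHom.mk' (fun g ↦ eU ⟨U.index • g, U.nsmul_index_mem g⟩) (fun g h ↦ by
    rw [← map_add]; exact congrArg eU (Subtype.ext (smul_add _ _ _)))
  have hφ : ∀ g, φ g = eU ⟨U.index • g, U.nsmul_index_mem g⟩ := fun _ ↦ rfl
  have hφU : ∀ u : U, φ u = U.index • eU u := fun u ↦ by
    rw [hφ, ← map_nsmul]; exact congrArg eU (Subtype.ext rfl)
  have hker : ∀ {g : G}, φ g = 0 → IsOfFinAddOrder g := fun {g} hg ↦ by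
    rw [hφ, eU.map_eq_zero_iff, Subtype.ext_iff, ZeroMemClass.coe_zero] at hg
    exact isOfFinAddOrder_iff_nsmul_eq_zero.mpr ⟨U.index, Nat.pos_of_ne_zero hN, hg⟩
  have hNmem : ∀ z : ℤ_[2], (U.index : ℤ_[2]) * z ∈ φ.range := fun z ↦
    ⟨(eU.symm z : U), by rw [hφU, AddEquiv.apply_symm_apply, nsmul_eq_mul]⟩
  -- `2^a ℤ₂ ⊆ range φ`, `N = 2^a m` with `m` odd
  obtain ⟨a, m, hm, hNam⟩ := Nat.exists_eq_two_pow_mul_odd hN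
  obtain ⟨mu, hmu⟩ : IsUnit (m : ℤ_[2]) :=
    PadicInt.isUnit_iff.mpr (PadicInt.norm_natCast_eq_one_iff.mpr (Nat.coprime_two_left.mpr hm))
  have hpow : ∀ w : ℤ_[2], (2 : ℤ_[2]) ^ a * w ∈ φ.range := fun w ↦ by
    have h := hNmem (↑mu⁻¹ * w)
    rwa [hNam, Nat.cast_mul, Nat.cast_pow, Nat.cast_ofNat, ← hmu, mul_assoc, Units.mul_inv_cancel_left] at h
  -- `range φ` is a non-zero ideal
  let I : Ideal ℤ_[2] :=
    { carrier := φ.range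
      add_mem' := fun hx hy ↦ φ.range.add_mem hx hy
      zero_mem' := φ.range.zero_mem
      smul_mem' := fun c x hx ↦ by
        obtain ⟨g, rfl⟩ := hx
        obtain ⟨μ, hμ⟩ := Ideal.mem_span_singleton'.mp (PadicInt.appr_spec a c)
        rw [smul_eq_mul, show c = ((c.appr a : ℕ) : ℤ_[2]) + (c - (c.appr a : ℕ)) by ring, add_mul, ← hμ, ← nsmul_eq_mul,
          ← map_nsmul, Nat.cast_ofNat, mul_comm μ, mul_assoc]
        exact φ.range.add_mem ⟨_, rfl⟩ (hpow _) }
  have hmem : ∀ s, s ∈ I ↔ s ∈ φ.range := fun _ ↦ Iff.rfl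
  have hI0 : I ≠ ⊥ := by
    rw [ne_eq, Submodule.eq_bot_iff]
    push Not
    refine ⟨(U.index : ℤ_[2]) * 1, (hmem _).mpr (hNmem 1), ?_⟩
    rw [mul_one, Nat.cast_ne_zero]
    exact hN
  -- read the trichotomy of `I/2I` back in `G`
  have back : ∀ {g : G} {s' : ℤ_[2]}, s' ∈ I → φ g = 2 * s' → ∃ z : G, IsOfFinAddOrder (g - 2 • z) := by
    intro g s' hs' hg
    obtain ⟨z, hz⟩ := (hmem s').mp hs'
    refine ⟨z, hker ?_⟩
    rw [map_sub, map_nsmul, hz, hg, nsmul_eq_mul, Nat.cast_ofNat, sub_self]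
  rcases ideal_two_trichotomy I hI0 ((hmem _).mpr ⟨x, rfl⟩) ((hmem _).mpr ⟨y, rfl⟩) with ⟨s', hs', h⟩ | ⟨t', ht', h⟩ | ⟨w, hw, h⟩
  · exact Or.inl (back hs' h)
  · exact Or.inr (Or.inl (back ht' h))
  · exact Or.inr (Or.inr (back hw (by rw [map_sub, h])))

end Group

/-! ## §3. Halving up to `2`-power torsion, and the point trichotomy (P-cyc) -/

section Halving

variable {Γ : Type*} [Monoid Γ] {A : Type*} [AddCommGroup A] [DistribMulAction Γ A]

/-- **Halving lemma.** If `2R = Q + t` with `Q` fixed, `2^k t = 0`, and `Q − 2S` is torsion for some fixed `S`, then `R` is fixed up to a `2`-power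
torsion point: with `w = R − S`, `o` the odd part of the order of `Q − 2S` and `o α = 1 + 2^{k+1} q`, `t₂ = oα • w` is `2`-power torsion and
`R − t₂ = S − 2^{k+1}q • w` is fixed (`σ w − w` is killed by `2^{k+1}`). [folklore] -/
theorem exists_twoPow_torsion_sub_fixed {R Q t S : A} (hQ : ∀ σ : Γ, σ • Q = Q) (hS : ∀ σ : Γ, σ • S = S) {k : ℕ} (ht : 2 ^ k • t = 0)
    (h2R : 2 • R = Q + t) (hs : IsOfFinAddOrder (Q - 2 • S)) :
    ∃ t₂ : A, (∃ k' : ℕ, 2 ^ k' • t₂ = 0) ∧ ∀ σ : Γ, σ • (R - t₂) = R - t₂ := by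
  -- `σ` acts by the additive map `f σ`
  have hf : ∀ (σ : Γ) (n : ℕ) (x : A), σ • (n • x) = n • (σ • x) := fun σ n x ↦ map_nsmul (DistribSMul.toAddMonoidHom A σ) n x
  set w := R - S with hw
  have hR : R = S + w := by rw [hw]; abel
  have h2w : 2 • w = (Q - 2 • S) + t := by rw [hw, smul_sub, h2R]; abel
  -- the order `n = 2^c o` of `Q − 2S`
  obtain ⟨n, hn, hns⟩ := isOfFinAddOrder_iff_nsmul_eq_zero.mp hs
  obtain ⟨c, o, ho, rfl⟩ := Nat.exists_eq_two_pow_mul_odd hn.ne'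
  -- (i) `o • w` is `2`-power torsion
  have how : 2 ^ (c + k + 1) • (o • w) = 0 := by
    have e1 : 2 ^ (c + k + 1) • (o • w) = (2 ^ k * (2 ^ c * o)) • (2 • w) := by
      rw [smul_smul, smul_smul]; congr 1; ring
    rw [e1, h2w, smul_add, mul_smul, hns, smul_zero, zero_add, mul_comm, mul_smul, ht, smul_zero]
  -- (ii) `σ w − w` is killed by `2^{k+1}`
  have hd : ∀ σ : Γ, 2 ^ (k + 1) • (σ • w - w) = 0 := by
    intro σ
    have e2 : 2 • (σ • w - w) = σ • t - t := by
      rw [smul_sub, ← hf, h2w, smul_add, smul_sub, hf, hQ, hS]; abel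
    rw [pow_succ, mul_smul, e2, smul_sub, ← hf, ht, smul_zero, sub_zero]
  -- (iii) `o α = 2^{k+1} q + 1`
  have hco : Nat.Coprime o (2 ^ (k + 1)) :=
    (Nat.coprime_comm.mp ((Nat.Prime.coprime_iff_not_dvd Nat.prime_two).mpr
      (fun h2 ↦ (Nat.not_even_iff_odd.mpr ho) (even_iff_two_dvd.mpr h2)))).pow_right _
  obtain ⟨α, -, hα⟩ := Nat.exists_mul_mod_eq_one_of_coprime hco (Nat.one_lt_two_pow (Nat.succ_ne_zero k))
  have hoα : o * α = 2 ^ (k + 1) * (o * α / 2 ^ (k + 1)) + 1 := by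
    conv_lhs => rw [← Nat.div_add_mod (o * α) (2 ^ (k + 1)), hα]
  set q := o * α / 2 ^ (k + 1) with hq
  -- (iv) `t₂ = oα • w`
  refine ⟨(o * α) • w, ⟨c + k + 1, ?_⟩, fun σ ↦ ?_⟩
  · rw [mul_comm o α, mul_smul, smul_comm (2 ^ (c + k + 1)) α, how, smul_zero]
  · have e3 : R - (o * α) • w = S - q • (2 ^ (k + 1) • w) := by
      rw [hoα, add_smul, one_smul, mul_comm, mul_smul, hR]; abel
    have e4 : q • (2 ^ (k + 1) • (σ • w)) = q • (2 ^ (k + 1) • w) := by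
      rw [← sub_eq_zero, ← smul_sub, ← smul_sub, hd, smul_zero]
    rw [e3, smul_sub, hS, hf, hf, e4]

/-- **POINT TRICHOTOMY (P-cyc) from the structure of the rational points.** Let `Γ` act on `A` (think `A = E(K̄_v)`, `Γ = Γ_{K_v}`), let
`ψ : G₀ → A` be additive with image the fixed points (think `E(K_v) ↪ E(K̄_v)`), and let `G₀` have a finite-index subgroup `≃+ ℤ_[2]`. Then for
`R, R′ ∈ A` with `2R`, `2R′` fixed up to `2`-power torsion, one of `R`, `R′`, `R′ − R` is fixed up to `2`-power torsion — the hypothesis `Hcyc` of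
`CMPrimes.loc_localKerOver_cyclic_of_points`. [cite: SilvermanAEC2009, Prop. VII.6.3] [cite: GreenbergLNM1716, §2 Prop. 2.1] -/
theorem point_trichotomy {G₀ : Type*} [AddCommGroup G₀] (U : AddSubgroup G₀) [U.FiniteIndex] (eU : U ≃+ ℤ_[2]) (ψ : G₀ →+ A)
    (hψ : ∀ P : G₀, ∀ σ : Γ, σ • ψ P = ψ P) (hψ' : ∀ Q : A, (∀ σ : Γ, σ • Q = Q) → ∃ P : G₀, ψ P = Q) (R R' : A)
    (hR : ∃ Q t : A, (∀ σ : Γ, σ • Q = Q) ∧ (∃ k : ℕ, 2 ^ k • t = 0) ∧ 2 • R = Q + t)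
    (hR' : ∃ Q t : A, (∀ σ : Γ, σ • Q = Q) ∧ (∃ k : ℕ, 2 ^ k • t = 0) ∧ 2 • R' = Q + t) :
    (∃ t : A, (∃ k : ℕ, 2 ^ k • t = 0) ∧ ∀ σ : Γ, σ • (R - t) = R - t) ∨
      (∃ t : A, (∃ k : ℕ, 2 ^ k • t = 0) ∧ ∀ σ : Γ, σ • (R' - t) = R' - t) ∨
      (∃ t : A, (∃ k : ℕ, 2 ^ k • t = 0) ∧ ∀ σ : Γ, σ • (R' - R - t) = R' - R - t) := by
  have hf : ∀ (σ : Γ) (n : ℕ) (x : A), σ • (n • x) = n • (σ • x) := fun σ n x ↦ map_nsmul (DistribSMul.toAddMonoidHom A σ) n x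
  obtain ⟨Q, t, hQ, ⟨k, hk⟩, h2R⟩ := hR
  obtain ⟨Q', t', hQ', ⟨k', hk'⟩, h2R'⟩ := hR'
  obtain ⟨P, rfl⟩ := hψ' Q hQ
  obtain ⟨P', rfl⟩ := hψ' Q' hQ'
  -- torsion passes along `ψ`
  have htor : ∀ {x : G₀}, IsOfFinAddOrder x → IsOfFinAddOrder (ψ x) := fun hx ↦ ψ.isOfFinAddOrder hx
  rcases trichotomy_of_finiteIndex_addEquiv_padicInt U eU P' P with ⟨z, hz⟩ | ⟨z, hz⟩ | ⟨z, hz⟩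
  · -- `Q′ − 2 ψ z` torsion: `R′` is fixed up to `2`-power torsion
    refine Or.inr (Or.inl (exists_twoPow_torsion_sub_fixed hQ' (hψ z) hk' h2R' ?_))
    have := htor hz; rwa [map_sub, map_nsmul] at this
  · refine Or.inl (exists_twoPow_torsion_sub_fixed hQ (hψ z) hk h2R ?_)
    have := htor hz; rwa [map_sub, map_nsmul] at this
  · -- `Q′ − Q − 2 ψ z` torsion: `R′ − R` is fixed up to `2`-power torsion
    refine Or.inr (Or.inr (exists_twoPow_torsion_sub_fixed (Q := ψ P' - ψ P) (t := t' - t) (S := ψ z) (k := k + k')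
      (fun σ ↦ by rw [smul_sub, hQ, hQ']) (hψ z) ?_ ?_ ?_))
    · rw [smul_sub, pow_add, mul_smul, hk', smul_zero, mul_comm, mul_smul, hk, smul_zero, sub_zero]
    · rw [smul_sub, h2R, h2R']; abel
    · have := htor hz; rwa [map_sub, map_sub, map_nsmul] at this

end Halving

/-! ## §4. The dictionary `E(K_v) = E(K̄_v)^{Γ_{K_v}}` and (P-cyc) on the frame -/

section Dictionary

open WeierstrassCurve Literature.NumberTheory.EllipticCurves

universe u

variable {K : Type u} [Field K] (V : WeierstrassCurve K) (E : Type u) [Field E] [Algebra K E]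

/-- **`E(K_v) → E(K̄_v)` lands in the `Γ_{K_v}`-fixed points** (coordinates in `K_v` are fixed by `Aut_{K_v}(K̄_v)`). The converse is the tree's
`exists_map_eq_of_forall_smul_localPoints_eq`. [cite: SilvermanAEC2009, VIII §1] -/
theorem smul_map_baseChange_eq (ψ : (V.baseChange E).toAffine.Point →+ localPoints V E)
    (hψ : ψ = Affine.Point.map (W' := V) (IsScalarTower.toAlgHom K E (AlgebraicClosure E)))
    (P : (V.baseChange E).toAffine.Point) (σ : Field.absoluteGaloisGroup E) : σ • ψ P = ψ P := by
  rcases P with _ | ⟨x, y, h⟩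
  · change σ • ψ 0 = ψ 0
    rw [map_zero, smul_zero]
  · subst hψ
    rw [localPoints.smul_def]
    change Affine.Point.map _ (Affine.Point.map _ (Affine.Point.some x y h)) = Affine.Point.map _ (Affine.Point.some x y h)
    rw [Affine.Point.map_some, Affine.Point.map_some, Affine.Point.some.injEq]
    exact ⟨σ.commutes x, σ.commutes y⟩

end Dictionary

section Frame

open NumberField IsDedekindDomain Field WeierstrassCurve
open Literature.NumberTheory.EllipticCurves Literature.NumberTheory.EllipticCurves.GreenbergSelmer
open Literature.NumberTheory.EllipticCurves.ResKernel
open Literature.NumberTheory.GaloisRepresentations (LocalField.adicCompletionPadicAlgebra)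

variable {K : Type} [Field K] [NumberField K]

/-- **(P-cyc) AT A DYADIC PLACE OF AN IMAGINARY QUADRATIC FIELD WITH `2` SPLIT.** For `V/K` elliptic, `K` imaginary quadratic, `v ≠ v̄` above `2`
(`K_v ≅ ℚ₂`): of any two points `R, R′ ∈ E(K̄_v)` with `2R`, `2R′ ∈ E(K_v) + E[2^∞]`, one of `R`, `R′`, `R′ − R` lies in `E(K_v) + E[2^∞]` —
the hypothesis `Hcyc` of `CMPrimes.loc_localKerOver_cyclic_of_points`. From `E(K_v) ⊇ U ≅ ℤ₂` of finite index (-w7 g3, Silverman VII.6.3)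
through `point_trichotomy`. [cite: SilvermanAEC2009, Prop. VII.6.3] [cite: GreenbergLNM1716, §2 Prop. 2.1] -/
theorem point_trichotomy_adicCompletion_two (hK : IsImaginaryQuadratic K) {v vbar : HeightOneSpectrum (𝓞 K)}
    (hv : ((2 : ℕ) : 𝓞 K) ∈ v.asIdeal) (hvbar : ((2 : ℕ) : 𝓞 K) ∈ vbar.asIdeal) (hne : vbar ≠ v) (V : WeierstrassCurve K) [V.IsElliptic] :
    ∀ R R' : localPoints V (v.adicCompletion K),
      (∃ Q t : localPoints V (v.adicCompletion K), (∀ σ : absoluteGaloisGroup (v.adicCompletion K), σ • Q = Q) ∧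
        (∃ k : ℕ, 2 ^ k • t = 0) ∧ 2 • R = Q + t) →
      (∃ Q t : localPoints V (v.adicCompletion K), (∀ σ : absoluteGaloisGroup (v.adicCompletion K), σ • Q = Q) ∧
        (∃ k : ℕ, 2 ^ k • t = 0) ∧ 2 • R' = Q + t) →
      (∃ t : localPoints V (v.adicCompletion K), (∃ k : ℕ, 2 ^ k • t = 0) ∧
          ∀ σ : absoluteGaloisGroup (v.adicCompletion K), σ • (R - t) = R - t) ∨
        (∃ t : localPoints V (v.adicCompletion K), (∃ k : ℕ, 2 ^ k • t = 0) ∧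
          ∀ σ : absoluteGaloisGroup (v.adicCompletion K), σ • (R' - t) = R' - t) ∨
        (∃ t : localPoints V (v.adicCompletion K), (∃ k : ℕ, 2 ^ k • t = 0) ∧
          ∀ σ : absoluteGaloisGroup (v.adicCompletion K), σ • (R' - R - t) = R' - R - t) := by
  haveI : Fact (Nat.Prime 2) := ⟨Nat.prime_two⟩
  haveI : CharZero (v.adicCompletion K) := charZero_of_injective_algebraMap (algebraMap K _).injective
  haveI : (V.baseChange (v.adicCompletion K)).IsElliptic := inferInstanceAs ((V.map (algebraMap K _)).IsElliptic)
  letI : Algebra ℚ_[2] (v.adicCompletion K) := LocalField.adicCompletionPadicAlgebra v 2 hv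
  have h1 : Module.finrank ℚ_[2] (v.adicCompletion K) = 1 := by
    rw [Literature.NumberTheory.NumberFields.finrank_adicCompletionPadicAlgebra_eq 2 v hv]
    exact LocalPointsScalar.ramificationIdx_mul_inertiaDeg_eq_one_of_ne hK.1 hv hvbar hne
  haveI : FiniteDimensional ℚ_[2] (v.adicCompletion K) := Module.finite_of_finrank_pos (by rw [h1]; exact one_pos)
  obtain ⟨U, hU, ⟨eU⟩⟩ := LocalPointsScalar.exists_finiteIndex_addEquiv_padicInt_of_finrank_eq_one 2 h1 (V.baseChange (v.adicCompletion K))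
  haveI := hU
  set ψ : (V.baseChange (v.adicCompletion K)).toAffine.Point →+ localPoints V (v.adicCompletion K) :=
    Affine.Point.map (W' := V) (IsScalarTower.toAlgHom K (v.adicCompletion K) (AlgebraicClosure (v.adicCompletion K))) with hψ
  intro R R' hR hR'
  exact point_trichotomy (A := localPoints V (v.adicCompletion K)) U eU ψ (smul_map_baseChange_eq V (v.adicCompletion K) ψ hψ)
    (fun Q hQ ↦ by obtain ⟨P, hP⟩ := exists_map_eq_of_forall_smul_localPoints_eq V (v.adicCompletion K) hQ; exact ⟨P, by rw [hψ]; exact hP⟩)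
    R R' hR hR'

/-- **(T-loc-cl) AT `v` ON EVERY FRAME FIELD**: for `V/K` elliptic, `K` imaginary quadratic, `2 = v·v̄`: the `2`-torsion of `loc_v` of the
classical-at-`v` classes of `H¹(⊤, E[2^∞])` is cyclic (-w8 g2's `CMPrimes.loc_localKerOver_cyclic_of_points` fed with (P-cyc)).
[cite: GreenbergLNM1716, §2 Prop. 2.1–2.2] [cite: SilvermanAEC2009, Prop. VII.6.3] -/
theorem classical_local_cyclic (hK : IsImaginaryQuadratic K) {v vbar : HeightOneSpectrum (𝓞 K)}
    (hv : ((2 : ℕ) : 𝓞 K) ∈ v.asIdeal) (hvbar : ((2 : ℕ) : 𝓞 K) ∈ vbar.asIdeal) (hne : vbar ≠ v) (V : WeierstrassCurve K) [V.IsElliptic] :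
    ∀ x ∈ (V.localKerOver 2 ⊤ (v.adicCompletion K)).map (resOfLe ↥(V.geomPrimaryTorsion 2) (inf_le_left : ⊤ ⊓ decomp v ≤ ⊤)),
      ∀ y ∈ (V.localKerOver 2 ⊤ (v.adicCompletion K)).map (resOfLe ↥(V.geomPrimaryTorsion 2) (inf_le_left : ⊤ ⊓ decomp v ≤ ⊤)),
      2 • x = 0 → 2 • y = 0 → x ≠ 0 → ∃ m : ℤ, y = m • x := by
  haveI : Fact (Nat.Prime 2) := ⟨Nat.prime_two⟩
  exact CMPrimes.loc_localKerOver_cyclic_of_points V 2 v (point_trichotomy_adicCompletion_two hK hv hvbar hne V)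

end Frame

end Summit.BirchSwinnertonDyer.BirchSwinnertonDyer.Theorems.PrintCf2.LocalTrichotomy

end
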